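import Literature.Computability.MetaComplexity.LanguageCompressionNP
import Literature.Computability.MetaComplexity.LanguageCompressionBounds
import HarnessLib

/-!
# Complexity meta: Claim 4.7 of Hirahara 2021 — the heuristic distinguishes `DP_k(x; ·)` on accepted no-instances

Topic `Literature/Computability/MetaComplexity`, part of the inline proof plan of
`Hirahara2021_languageCompression` (S. Hirahara, ECCC TR21-058 (2021), Thm. 4.2; Claim 4.7 and its
proof, pp. 28–29). Theorems only: the probability estimates of the proof of Claim 4.7 (2), for the
slices `⟨n, k, t⟩` of `L' = dpLang L` (`LanguageCompressionNP.lean`) and a heuristic `D₀` that accepts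
every member of `L'` and is correct with probability `≥ s` on a uniformly random sample:

* `uniformProb_accept_le` — **Eq. (8)**: `Pr_w[B(w) = 1] ≤ Pr_w[L'(w) = 1] + Pr_w[B(w) ≠ L'(w)]`;
* `slice_le_half` — **Eq. (6) with the choice of `k`**: if `|L_t| ≤ 2^κ`, `k = κ + Λ` and
  `2^Λ ≥ 2/s`, then `Pr_w[L'(w) = 1] ≤ s/2` (the union bound `uniformProb_dpLang_slice_le`);
* `dpAdvantage_ge` — **Claim 4.7 (2), the distinguishing step**: if moreover
  `Pr_z[B(DP_k(x; z)) = 1] ≥ 1 - s/4` then `B(·, 1^{⟨n,k,t⟩})` `s/4`-distinguishes `DP_k(x; ·)` from the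
  uniform distribution ("By Eqs. (7) and (8), we obtain … `≥ ⟨n,t⟩^{-c'}/4`");
* `log_poly_ge` — the logarithm of the final polynomial `p(t) = 2^{C+4} (2(t+2))^E Q(t)` dominates
  `C + 4 + Λ(t) + log Q(t)` ("letting `p(t) := 4q(t)t^d`", p. 29, in `Nat.log 2` form).

## References

* S. Hirahara, ECCC TR21-058 (2021), proof of Thm. 4.2, Claim 4.7 (pp. 28–29) [Hirahara2021].
-/

noncomputable section

namespace Literature.Computability.MetaComplexity

open _root_.Computability Complexity Complexity.Classes

namespace LCClaim

variable {D₀ L : Language Bool}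

/-- **Eq. (8)**: for a heuristic `D₀` correct on `L'` with probability `≥ s` at the slice `⟨n,k,t⟩`,
`Pr_w[D₀ accepts (w, 1^{⟨n,k,t⟩})] ≤ Pr_w[(w, 1^{⟨n,k,t⟩}) ∈ L'] + (1 - s)`.
[cite: Hirahara2021, Thm. 4.2 (proof of Claim 4.7, Eq. (8))] -/
theorem uniformProb_accept_le {n k t : ℕ} {s B : ℝ}
    (hcorrect : s ≤ uniformProb (n * k + k)
      {w | paramEnc (w, idx3 n k t) ∈ D₀ ↔ paramEnc (w, idx3 n k t) ∈ dpLang L})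
    (hslice : uniformProb (n * k + k) {w | paramEnc (w, idx3 n k t) ∈ dpLang L} ≤ B) :
    uniformProb (n * k + k) {w | paramEnc (w, idx3 n k t) ∈ D₀} ≤ B + (1 - s) := by
  have hsub : {w | paramEnc (w, idx3 n k t) ∈ D₀} ⊆
      {w | paramEnc (w, idx3 n k t) ∈ dpLang L} ∪
        {w | paramEnc (w, idx3 n k t) ∈ D₀ ↔ paramEnc (w, idx3 n k t) ∈ dpLang L}ᶜ := by
    intro w hw
    by_cases h : paramEnc (w, idx3 n k t) ∈ dpLang L
    · exact Or.inl h
    · right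
      simp only [Set.mem_compl_iff, Set.mem_setOf_eq]
      exact fun hiff => h (hiff.1 hw)
  have hmono : uniformProb (n * k + k) {w | paramEnc (w, idx3 n k t) ∈ D₀} ≤
      uniformProb (n * k + k) ({w | paramEnc (w, idx3 n k t) ∈ dpLang L} ∪
        {w | paramEnc (w, idx3 n k t) ∈ D₀ ↔ paramEnc (w, idx3 n k t) ∈ dpLang L}ᶜ) := by
    rw [uniformProb_eq_cnt_div, uniformProb_eq_cnt_div]
    refine div_le_div_of_nonneg_right ?_ (by positivity)
    exact_mod_cast (by
      unfold cnt
      exact Finset.card_le_card fun r hr => by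
        simp only [Finset.mem_filter, Finset.mem_univ, true_and] at hr ⊢
        exact hsub hr)
  refine hmono.trans ((uniformProb_union_le _ _ _).trans ?_)
  rw [uniformProb_compl]
  linarith

/-- **Eq. (6) with the choice of `k`**: for an ensemble `L` with `|L_t| ≤ 2^κ`, `k = κ + Λ` and
`2^Λ ≥ 2/s` (`s > 0`), the slice has probability `≤ s/2`:
`|L_t ∩ {0,1}ⁿ| · 2^{-k} ≤ 2^κ · 2^{-κ-Λ} ≤ s/2`. [cite: Hirahara2021, Thm. 4.2 (proof, Eq. (6): "≤ A(1ᵗ) · 2^{-k(t)} = t^{-d}")] -/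
theorem slice_le_half (hens : IsLanguageEnsemble L) {n k t κ Λ : ℕ} (hk : k = κ + Λ)
    (hsize : (languageSlice L t).ncard ≤ 2 ^ κ) {s : ℝ} (hs : 0 < s) (hslack : 2 / s ≤ (2 : ℝ) ^ Λ) :
    uniformProb (n * k + k) {w | paramEnc (w, idx3 n k t) ∈ dpLang L} ≤ s / 2 := by
  refine (uniformProb_dpLang_slice_le hens n k t).trans ?_
  have hfin := hens.finite_languageSlice t
  have hsub : (languageSlice L t ∩ {x : List Bool | x.length = n}).ncard ≤ (languageSlice L t).ncard :=
    Set.ncard_le_ncard Set.inter_subset_left hfin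
  have hnum : ((languageSlice L t ∩ {x : List Bool | x.length = n}).ncard : ℝ) ≤ (2 : ℝ) ^ κ := by
    exact_mod_cast hsub.trans hsize
  have hΛpos : (0 : ℝ) < 2 ^ Λ := by positivity
  have hκpos : (0 : ℝ) < 2 ^ κ := by positivity
  rw [hk, pow_add, div_le_iff₀ (by positivity)]
  -- `ncard ≤ 2^κ` and `s/2 · 2^κ · 2^Λ ≥ s/2 · 2^κ · (2/s) = 2^κ`
  have h1 : s / 2 * (2 : ℝ) ^ Λ ≥ 1 := by
    have := mul_le_mul_of_nonneg_left hslack (show (0 : ℝ) ≤ s / 2 by positivity)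
    rw [show s / 2 * (2 / s) = 1 by field_simp] at this
    exact this
  nlinarith

/-- **Claim 4.7 (2), the distinguishing step**: if `D₀` is correct on `L'` with probability `≥ s` at
the slice `⟨n, k, t⟩` (`n = |x|`), the slice has probability `≤ s/2`, and `D₀` accepts `DP_k(x; z)`
for at least a `1 - s/4` fraction of the seeds, then the test `w ↦ [(w, 1^{⟨n,k,t⟩}) ∈ D₀]`
`s/4`-distinguishes `DP_k(x; ·)` from uniform (`Pr_z ≥ 1 - s/4` against `Pr_w ≤ s/2 + 1 - s`).
[cite: Hirahara2021, Thm. 4.2 (Claim 4.7 (2), "By Eqs. (7) and (8) … ≥ ⟨n,t⟩^{-c'}/4")] -/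
theorem dpAdvantage_ge {x : List Bool} {k t : ℕ} {s : ℝ}
    (hcorrect : s ≤ uniformProb (x.length * k + k)
      {w | paramEnc (w, idx3 x.length k t) ∈ D₀ ↔ paramEnc (w, idx3 x.length k t) ∈ dpLang L})
    (hslice : uniformProb (x.length * k + k) {w | paramEnc (w, idx3 x.length k t) ∈ dpLang L} ≤ s / 2)
    (hacc : 1 - s / 4 ≤ uniformProb (x.length * k) {z | paramEnc (dpGen k x z, idx3 x.length k t) ∈ D₀}) :
    s / 4 ≤ dpAdvantage k x (fun w => D₀.boolIndicator (paramEnc (w, idx3 x.length k t))) := by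
  have hacc' : 1 - s / 4 ≤ uniformProb (x.length * k)
      {z | (fun w => D₀.boolIndicator (paramEnc (w, idx3 x.length k t))) (dpGen k x z) = true} := by
    refine hacc.trans_eq (congr_arg _ (Set.ext fun z => ?_))
    simp only [Set.mem_setOf_eq]
    exact Set.mem_iff_boolIndicator _ _
  have hw : uniformProb (x.length * k + k) {w | (fun w => D₀.boolIndicator (paramEnc (w, idx3 x.length k t))) w = true} ≤
      (1 - s / 4) - s / 4 := by
    have h := uniformProb_accept_le hcorrect hslice
    have hset : {w | (fun w => D₀.boolIndicator (paramEnc (w, idx3 x.length k t))) w = true} =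
        {w | paramEnc (w, idx3 x.length k t) ∈ D₀} := Set.ext fun w => (Set.mem_iff_boolIndicator _ _).symm
    rw [hset]
    linarith
  exact le_dpAdvantage_of_le_of_le hacc' hw

/-- **The logarithm of the final polynomial**: for `p = 2^{C+4} · (2(t+2))^E · Q` with `Q ≥ 1`,
`log p ≥ C + 4 + E(log (t+2) + 1) + log Q` (`Nat.log 2`; superadditivity).
[cite: Hirahara2021, Thm. 4.2 (proof of Claim 4.7, "letting p(t) := 4q(t)t^d")] -/
theorem log_poly_ge (C E t : ℕ) {Q : ℕ} (hQ : 0 < Q) :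
    C + 4 + E * (Nat.log 2 (t + 2) + 1) + Nat.log 2 Q ≤ Nat.log 2 (2 ^ (C + 4) * (2 * (t + 2)) ^ E * Q) := by
  have hpos : 0 < (2 * (t + 2)) ^ E := pow_pos (by omega) E
  have h1 : E * (Nat.log 2 (t + 2) + 1) ≤ Nat.log 2 ((2 * (t + 2)) ^ E) := by
    calc E * (Nat.log 2 (t + 2) + 1) = E * (1 + Nat.log 2 (t + 2)) := by ring
      _ ≤ E * Nat.log 2 (2 * (t + 2)) := Nat.mul_le_mul_left E (LCBounds.one_add_log_le_log_two_mul (by omega))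
      _ ≤ Nat.log 2 ((2 * (t + 2)) ^ E) := LCBounds.mul_log_le_log_pow E _
  have h2 : Nat.log 2 ((2 * (t + 2)) ^ E) + Nat.log 2 Q ≤ Nat.log 2 ((2 * (t + 2)) ^ E * Q) :=
    LCBounds.log_add_log_le hpos hQ
  have h3 : C + 4 + Nat.log 2 ((2 * (t + 2)) ^ E * Q) ≤ Nat.log 2 (2 ^ (C + 4) * ((2 * (t + 2)) ^ E * Q)) :=
    LCBounds.add_log_le_log_two_pow_mul (C + 4) (Nat.mul_pos hpos hQ)
  rw [mul_assoc]
  omega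

end LCClaim

end Literature.Computability.MetaComplexity
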